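import Summits.KontsevichZagierPeriods.Zeta5Search.WedgeDictionarySlotSeven
import HarnessLib

/-!
# CF-M3 two steps into the interior: all shapes with `min_j b_j ≤ 2` (cell `pub-zeta5`)

HONEST FRAMING: systematic search; no irrationality claim unless certified.

OUR work (Summit side; lead/literature seat generation 4, 2026-08-20). Second layer of step L9 of the cell's Lean
plan for the interior of CF-M3 (`casoratianClosedForm`; PROOF-NOTES-g5 §4.2–§4.3, §10.2): the initial identity I2.
For an admissible `b` with `b₇ = 2` let `a = b − 2e₇` (a face point) and `a' = a + e₇`. The second determinant
identity of `casoratian_pair_identities` at `a`, `γ₃·M₃(b) = γ₀·D(a) + γ₁·M₃(a')`, the two initial identities of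
`face_initial` (`d(a)·M₃(a') = q₀·M₃(a)`, `d(a)·D(a) = −γ₁'·M₃(a)`), the face theorem at `a`, two slot-7
bookkeeping steps and the value of `Ω` at `b₇ = 2`,
`Ω(b)·(N−2)E(N)E(N−1) = (N−2)E(N)E(N−1) − 2(N−1)e₆E(N−1) + N e₆ E(1)` (`E(t) = ∏_{i≤6}(t − b_i)`; only the terms
`m ≤ 2` of the very-well-poised sum survive), reduce CF-M3 at `b` to the polynomial identity I2 of the notes
(`coreI2`, one `ring`; it is gen-1 g5's `Telescope.initialTwo_cleared` written in the slots).

* `casoratianClosedForm_bseven_two`, `casoratianClosedForm_of_slot_le_two` (transport by `quadM3_swap`,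
  `omegaVWP_swap`): CF-M3 for every admissible `b` with some `b_j ≤ 2`.

What remains for `casoratianClosedForm` in full: the layers `b₇ ≥ 3` along slot 7, i.e. REC3 (`quadM3_rec3`, in the
tree) against the recurrence REC3′ of `Ω` (L8: `WedgeDictionaryTelescope` + summation), by induction (L9).
-/

noncomputable section

open Finset Polynomial

namespace Summit.KontsevichZagierPeriods.Zeta5Search.WedgeDictionary

open Summit.KontsevichZagierPeriods.Zeta5Search.DualSeries
open Literature.NumberTheory.Transcendental

/-! ### The slots through their elementary symmetric functions -/

/-- `∏_{i≤6}(x − b_i) = x⁶ − e₁x⁵ + e₂x⁴ − e₃x³ + e₄x² − e₅x + e₆`. -/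
theorem prod_sub_slots (b : ℕ → ℤ) (x : ℚ) :
    ∏ i ∈ range 6, (x - (b (i + 1) : ℚ)) =
      x ^ 6 - fe1 b * x ^ 5 + fe2 b * x ^ 4 - fe3 b * x ^ 3 + fe4 b * x ^ 2 - fe5 b * x + fe6 b := by
  simp only [fe1, fe2, fe3, fe4, fe5, fe6, prod_range_succ, prod_range_zero]
  ring

/-- `∏_{i≤6} b_i = e₆`. -/
theorem prod_slots (b : ℕ → ℤ) : ∏ i ∈ range 6, (b (i + 1) : ℚ) = fe6 b := by
  simp only [fe6, prod_range_succ, prod_range_zero]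
  ring

/-! ### `Ω` two steps into the interior -/

/-- For `b₇ = 2` (`N ≥ 4`, all `b_i + 2 ≤ N`):
`Ω(b)·(N−2)·∏(N−b_i)·∏(N−1−b_i) = (N−2)∏(N−b_i)∏(N−1−b_i) − 2(N−1)·∏b_i·∏(N−1−b_i) + N·∏b_i·∏(b_i−1)`
(only the terms `m ≤ 2` of the very-well-poised sum survive; slot by slot, no expansion). -/
theorem omegaVWP_bseven_two (b : ℕ → ℤ) (h7 : b 7 = 2) (hN : 4 ≤ b 0)
    (hc : ∀ i ∈ range 6, b (i + 1) + 2 ≤ b 0) :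
    omegaVWP b * (((b 0 : ℚ) - 2) * (∏ i ∈ range 6, ((b 0 : ℚ) - b (i + 1))) *
        ∏ i ∈ range 6, ((b 0 : ℚ) - 1 - b (i + 1))) =
      ((b 0 : ℚ) - 2) * (∏ i ∈ range 6, ((b 0 : ℚ) - b (i + 1))) * (∏ i ∈ range 6, ((b 0 : ℚ) - 1 - b (i + 1))) -
        2 * ((b 0 : ℚ) - 1) * (∏ i ∈ range 6, (b (i + 1) : ℚ)) * (∏ i ∈ range 6, ((b 0 : ℚ) - 1 - b (i + 1))) +
        (b 0 : ℚ) * (∏ i ∈ range 6, (b (i + 1) : ℚ)) * ∏ i ∈ range 6, ((b (i + 1) : ℚ) - 1) := by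
  have h67 : b (6 + 1) = 2 := h7
  have h7q : ((b 7 : ℤ) : ℚ) = 2 := by rw [h7]; push_cast; ring
  have hNn : (b 0).toNat + 1 = ((b 0).toNat - 2) + 1 + 1 + 1 := by omega
  have hne : ∀ i ∈ range 6, ((b (i + 1) : ℚ) - b 0) ≠ 0 ∧ ((b (i + 1) : ℚ) - b 0 + 1) ≠ 0 := by
    intro i hi
    have := hc i hi
    have : ((b (i + 1) : ℤ) : ℚ) + 2 ≤ ((b 0 : ℤ) : ℚ) := by exact_mod_cast this
    constructor <;> intro h <;> linarith
  have hN4 : (4 : ℚ) ≤ ((b 0 : ℤ) : ℚ) := by exact_mod_cast hN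
  have hd1 : ((2 : ℚ) - b 0) ≠ 0 := by intro h; linarith
  have hd2 : ((2 : ℚ) - b 0 + 1) ≠ 0 := by intro h; linarith
  have hd3 : ((b 0 : ℚ) + 1) ≠ 0 := by intro h; linarith
  have split7 : ∀ f : ℕ → ℚ, ∏ j ∈ range 7, f j = (∏ j ∈ range 6, f j) * f 6 := fun f => prod_range_succ f 6
  have hA2 : ascPochhammer ℚ 2 = X * (X + 1) := by
    rw [show (2 : ℕ) = 1 + 1 from rfl, ascPochhammer_succ_left, ascPochhammer_one]; simp
  unfold omegaVWP
  set F : ℕ → ℚ := fun m => (1 - 2 * (m : ℚ) / ((b 0 : ℚ) + 1)) *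
      ((ascPochhammer ℚ m).eval (-(b 0 : ℚ) - 1) / (m.factorial : ℚ)) *
      ∏ j ∈ range 7, (ascPochhammer ℚ m).eval (-(b (j + 1) : ℚ)) / (ascPochhammer ℚ m).eval ((b (j + 1) : ℚ) - b 0)
    with hF
  rw [hNn, sum_range_succ', sum_range_succ', sum_range_succ']
  -- the terms `m ≥ 3` vanish: the slot-7 numerator `(−2)_m = 0`
  rw [sum_eq_zero (fun m _ => by
    apply mul_eq_zero_of_right
    apply prod_eq_zero (mem_range.2 (by norm_num : 6 < 7))
    rw [h67, ascPochhammer_succ_left, eval_mul, eval_comp, eval_add, eval_X, eval_one, ascPochhammer_succ_left,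
      eval_mul, eval_comp, eval_add, eval_X, eval_one]
    push_cast
    rw [show (-2 : ℚ) + 1 + 1 = 0 by ring, ascPochhammer_eval_zero]
    simp), zero_add]
  simp only [Nat.reduceAdd]
  change (F 2 + F 1 + F 0) * _ = _
  -- the three surviving terms, slot products kept as atoms
  set U1 := ∏ i ∈ range 6, (-(b (i + 1) : ℚ)) / ((b (i + 1) : ℚ) - b 0) with hU1
  set U2 := ∏ i ∈ range 6, ((-(b (i + 1) : ℚ)) * (-(b (i + 1) : ℚ) + 1)) /
      (((b (i + 1) : ℚ) - b 0) * ((b (i + 1) : ℚ) - b 0 + 1)) with hU2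
  have hF0 : F 0 = 1 := by
    simp only [hF, Nat.cast_zero, ascPochhammer_zero, eval_one, Nat.factorial_zero, Nat.cast_one, div_one, mul_zero,
      zero_div, sub_zero, prod_const_one, mul_one]
  have hF1 : F 1 = (1 - 2 / ((b 0 : ℚ) + 1)) * (-(b 0 : ℚ) - 1) * (U1 * ((-2) / (2 - (b 0 : ℚ)))) := by
    simp only [hF, Nat.cast_one, ascPochhammer_one, eval_X, Nat.factorial_one, split7, h7q, hU1]
    ring
  have hF2 : F 2 = (1 - 2 * 2 / ((b 0 : ℚ) + 1)) * ((-(b 0 : ℚ) - 1) * (-(b 0 : ℚ) - 1 + 1) / 2) *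
      (U2 * ((-2) * (-2 + 1) / ((2 - (b 0 : ℚ)) * (2 - (b 0 : ℚ) + 1)))) := by
    simp only [hF, Nat.cast_ofNat, hA2, eval_mul, eval_add, eval_X, eval_one, Nat.factorial_two, split7, h7q, hU2]
  rw [hF0, hF1, hF2]
  -- slot-by-slot cancellations
  have R1 : U1 * ∏ i ∈ range 6, ((b 0 : ℚ) - b (i + 1)) = ∏ i ∈ range 6, (b (i + 1) : ℚ) := by
    rw [hU1, ← prod_mul_distrib]
    refine prod_congr rfl fun i hi => ?_
    have := (hne i hi).1
    field_simp
    ring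
  have R2 : U2 * ((∏ i ∈ range 6, ((b 0 : ℚ) - b (i + 1))) * ∏ i ∈ range 6, ((b 0 : ℚ) - 1 - b (i + 1))) =
      (∏ i ∈ range 6, (b (i + 1) : ℚ)) * ∏ i ∈ range 6, ((b (i + 1) : ℚ) - 1) := by
    rw [hU2, ← prod_mul_distrib, ← prod_mul_distrib, ← prod_mul_distrib]
    refine prod_congr rfl fun i hi => ?_
    obtain ⟨hne1, hne2⟩ := hne i hi
    field_simp
    ring
  have hα1 : (1 - 2 / ((b 0 : ℚ) + 1)) * (-(b 0 : ℚ) - 1) * ((-2) / (2 - (b 0 : ℚ))) * ((b 0 : ℚ) - 2) =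
      -2 * ((b 0 : ℚ) - 1) := by
    field_simp
    ring
  have hα2 : (1 - 2 * 2 / ((b 0 : ℚ) + 1)) * ((-(b 0 : ℚ) - 1) * (-(b 0 : ℚ) - 1 + 1) / 2) *
      ((-2) * (-2 + 1) / ((2 - (b 0 : ℚ)) * (2 - (b 0 : ℚ) + 1))) * ((b 0 : ℚ) - 2) = (b 0 : ℚ) := by
    field_simp
    ring
  linear_combination (U1 * (∏ i ∈ range 6, ((b 0 : ℚ) - b (i + 1))) * ∏ i ∈ range 6, ((b 0 : ℚ) - 1 - b (i + 1))) *
      hα1 + (-2 * ((b 0 : ℚ) - 1) * ∏ i ∈ range 6, ((b 0 : ℚ) - 1 - b (i + 1))) * R1 +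
    (U2 * (∏ i ∈ range 6, ((b 0 : ℚ) - b (i + 1))) * ∏ i ∈ range 6, ((b 0 : ℚ) - 1 - b (i + 1))) * hα2 +
      (b 0 : ℚ) * R2

/-! ### The identity I2 -/

/-- **I2** (PROOF-NOTES-g5 §4.3; gen-1 g5's `Telescope.initialTwo_cleared` in the slots): at a face point `a`
(`a₇ = 0`), with `γ_k = topGamma_k a`, `q₀, γ₁'` the coefficients of `face_threeTerm_seven` and
`E(t) = t⁶ − e₁t⁵ + ⋯ + e₆`:
`N(N−1)(N−2)·(γ₀γ₁' − γ₁q₀) = (N−2)E(N)E(N−1) − 2(N−1)e₆E(N−1) + N e₆ E(1)`. -/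
theorem coreI2 (a : ℕ → ℤ) (ha7 : a 7 = 0) :
    (a 0 : ℚ) * ((a 0 : ℚ) - 1) * ((a 0 : ℚ) - 2) *
        (topGamma0 a * ((4 * (a 0 : ℚ) ^ 3 - 3 * fe1 a * (a 0 : ℚ) ^ 2 + 2 * fe2 a * (a 0 : ℚ) - fe3 a) -
            ((a 0 : ℚ) - 1) * (dOf a : ℚ)) -
          topGamma1 a * ((a 0 : ℚ) ^ 5 - fe1 a * (a 0 : ℚ) ^ 4 + fe2 a * (a 0 : ℚ) ^ 3 - fe3 a * (a 0 : ℚ) ^ 2 +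
            fe4 a * (a 0 : ℚ) - fe5 a)) =
      ((a 0 : ℚ) - 2) *
            ((a 0 : ℚ) ^ 6 - fe1 a * (a 0 : ℚ) ^ 5 + fe2 a * (a 0 : ℚ) ^ 4 - fe3 a * (a 0 : ℚ) ^ 3 +
              fe4 a * (a 0 : ℚ) ^ 2 - fe5 a * (a 0 : ℚ) + fe6 a) *
            (((a 0 : ℚ) - 1) ^ 6 - fe1 a * ((a 0 : ℚ) - 1) ^ 5 + fe2 a * ((a 0 : ℚ) - 1) ^ 4 -
              fe3 a * ((a 0 : ℚ) - 1) ^ 3 + fe4 a * ((a 0 : ℚ) - 1) ^ 2 - fe5 a * ((a 0 : ℚ) - 1) + fe6 a) -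
          2 * ((a 0 : ℚ) - 1) * fe6 a *
            (((a 0 : ℚ) - 1) ^ 6 - fe1 a * ((a 0 : ℚ) - 1) ^ 5 + fe2 a * ((a 0 : ℚ) - 1) ^ 4 -
              fe3 a * ((a 0 : ℚ) - 1) ^ 3 + fe4 a * ((a 0 : ℚ) - 1) ^ 2 - fe5 a * ((a 0 : ℚ) - 1) + fe6 a) +
        (a 0 : ℚ) * fe6 a * (1 - fe1 a + fe2 a - fe3 a + fe4 a - fe5 a + fe6 a) := by
  have h7q : (a 7 : ℚ) = 0 := by rw [ha7]; push_cast; ring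
  have hd : (dOf a : ℚ) = 3 * (a 0 : ℚ) - fe1 a := by
    unfold dOf
    simp only [fe1, sum_range_succ, sum_range_zero, ha7]
    push_cast
    ring
  simp only [topGamma0, topGamma1, topA0, topA1, topA2, topA3, yNode, h7q, hd]
  ring

/-! ### CF-M3 for `b₇ = 2` -/

/-- **CF-M3 for every admissible `b` with `b₇ = 2`.** -/
theorem casoratianClosedForm_bseven_two (b : ℕ → ℤ) (hb : InBox b) (hd : 0 ≤ dOf b)
    (hle : ∀ j ∈ Icc 1 7, b j ≤ b 0) (hpairs : ∀ jk ∈ allPairs, b jk.1 + b jk.2 ≤ b 0) (h7 : b 7 = 2) :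
    quadM3 b * (((b 0).toNat.factorial : ℚ) *
        (allPairs.map fun jk => ((b 0 - b jk.1 - b jk.2).toNat.factorial : ℚ)).prod) =
      (-1 : ℚ) ^ (b 0).toNat * 4 * ((dOf b).toNat.factorial : ℚ) *
        (∏ j ∈ range 7, ((b 0 - b (j + 1)).toNat.factorial : ℚ)) * omegaVWP b := by
  -- shapes with a slot `≤ 1` are already settled
  by_cases hz : ∃ j ∈ Icc 1 7, b j ≤ 1
  · obtain ⟨j, hj, hj1⟩ := hz
    exact casoratianClosedForm_of_slot_le_one b hb hd hle hpairs hj hj1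
  push Not at hz
  have hi7 : (6 : ℕ) ∈ range 7 := mem_range.2 (by norm_num)
  have hpos : ∀ i ∈ range 6, 2 ≤ b (i + 1) := fun i hi => by
    have := hz (i + 1) (mem_Icc.2 ⟨by omega, by have := mem_range.1 hi; omega⟩); omega
  have hc : ∀ i ∈ range 6, b (i + 1) + 2 ≤ b 0 := fun i hi => by
    have := pair_le_of_allPairs hpairs (j := i + 1) (k := 7) (by omega) (by have := mem_range.1 hi; omega)
      (by norm_num) le_rfl (by have := mem_range.1 hi; omega)
    omega
  have hN4 : 4 ≤ b 0 := by have := hc 0 (by simp); have := hpos 0 (by simp); omega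
  -- the face point `a = b − 2e₇`; `bump a 6 = b − e₇`, `bump (bump a 6) 6 = b`
  set a : ℕ → ℤ := Function.update b 7 0 with ha
  have ha7 : a 7 = 0 := Function.update_self _ _ _
  have ha_ne : ∀ k, k ≠ 7 → a k = b k := fun k hk => Function.update_of_ne hk _ _
  have ha0 : a 0 = b 0 := ha_ne 0 (by norm_num)
  have e10 : bump a 6 0 = a 0 := bump_zero a 6
  have e17 : bump a 6 7 = a 7 + 1 := bump6_seven a
  have e1i : ∀ i ∈ range 6, bump a 6 (i + 1) = b (i + 1) := fun i hi => by
    rw [bump_of_ne a (by have := mem_range.1 hi; omega), ha_ne (i + 1) (by have := mem_range.1 hi; omega)]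
  have hbb : bump (bump a 6) 6 = b := by
    have h1 : bump a 6 = Function.update b 7 1 := by
      unfold bump
      rw [show (6 : ℕ) + 1 = 7 from rfl, ha7, zero_add, ha, Function.update_idem]
    rw [bump, show (6 : ℕ) + 1 = 7 from rfl, h1, Function.update_self, Function.update_idem,
      show ((1 : ℤ) + 1) = b 7 by rw [h7]; norm_num, Function.update_eq_self]
  have hmono : ∀ k, a k ≤ b k := fun k => by
    by_cases hk : k = 7
    · rw [hk, ha7, h7]; norm_num
    · rw [ha_ne k hk]
  have ha_box : InBox a := by
    refine ⟨by rw [ha0]; exact hb.1, fun j hj => ?_⟩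
    by_cases hj6 : j = 6
    · rw [hj6, show (6 : ℕ) + 1 = 7 from rfl, ha7, ha0]; constructor <;> omega
    · rw [ha_ne (j + 1) (by omega), ha0]; exact hb.2 j hj
  have hd1 : dOf (bump a 6) = dOf a - 1 := dOf_bump a hi7
  have hda : dOf a = dOf b + 2 := by
    have := dOf_bump (bump a 6) hi7; rw [hbb, hd1] at this; omega
  have hle_a : ∀ j ∈ Icc 1 7, a j ≤ a 0 := fun j hj => by rw [ha0]; exact (hmono j).trans (hle j hj)
  have hpairs_a : ∀ jk ∈ allPairs, a jk.1 + a jk.2 ≤ a 0 := fun jk hjk => by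
    rw [ha0]; have := hpairs jk hjk; have := hmono jk.1; have := hmono jk.2; omega
  -- (E1) the face theorem at `a`
  have CFa := casoratianClosedForm_face a ha_box (by omega) hle_a hpairs_a ha7
  rw [omegaVWP_eq_one (j := 6) hi7 ha7, mul_one, ha0, hda] at CFa
  -- (E2), (E3) the initial identities; (E4) the second determinant identity at `a`
  obtain ⟨initI, initII⟩ := face_initial a ha_box ha7 (by omega)
  have pairB := (casoratian_pair_identities a ha_box (by omega) (by rw [ha7, ha0]; omega)).2
  rw [hbb] at initII pairB
  rw [hda, ha0] at initI initII
  push_cast at initI initII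
  -- (E9) the identity I2 and (E10) `γ₃`
  have hI2 := coreI2 a ha7
  rw [hda, ha0] at hI2
  push_cast at hI2
  have hγ3 : topGamma3 a = -((dOf b : ℚ) + 1) := by rw [topGamma3_eq, hda]; push_cast; ring
  -- (E5)–(E7) two slot-7 bookkeeping steps
  have hprod1 : ∏ i ∈ range 6, ((a 0 : ℚ) - a (i + 1) - a 7) = ∏ i ∈ range 6, ((b 0 : ℚ) - b (i + 1)) :=
    prod_congr rfl fun i hi => by
      rw [ha0, ha_ne (i + 1) (by have := mem_range.1 hi; omega), ha7]; push_cast; ring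
  have hprod2 : ∏ i ∈ range 6, ((a 0 : ℚ) - bump a 6 (i + 1) - bump a 6 7) =
      ∏ i ∈ range 6, ((b 0 : ℚ) - 1 - b (i + 1)) :=
    prod_congr rfl fun i hi => by rw [ha0, e1i i hi, e17, ha7]; push_cast; ring
  have hP1 := pairProd_slot7_step a (fun i hi => by
    rw [ha_ne (i + 1) (by have := mem_range.1 hi; omega), ha7, ha0]; have := hc i hi; omega)
  rw [hprod1, ha0] at hP1
  have hP2 := pairProd_slot7_step (bump a 6) (fun i hi => by
    rw [e1i i hi, e17, e10, ha7, ha0]; have := hc i hi; omega)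
  rw [e10, hbb, hprod2, ha0] at hP2
  have hF1 := singles_slot7_step a (by rw [ha7, ha0]; omega)
  rw [ha7, ha0] at hF1
  push_cast at hF1
  have hF2 := singles_slot7_step (bump a 6) (by rw [e17, e10, ha7, ha0]; omega)
  rw [e10, hbb, e17, ha7, ha0] at hF2
  push_cast at hF2
  have hD1 := dfact_slot7_step a (by omega)
  have hD2 := dfact_slot7_step (bump a 6) (by rw [hd1]; omega)
  rw [hbb] at hD2
  rw [hd1, hda] at hD1 hD2
  push_cast at hD1 hD2
  -- (E8) `Ω(b)`
  have hΩ := omegaVWP_bseven_two b h7 hN4 hc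
  -- the slot products as polynomials in `e_k(a)` (`a` and `b` agree on the slots `1..6`)
  have hslot : ∀ i ∈ range 6, (b (i + 1) : ℚ) = (a (i + 1) : ℚ) := fun i hi => by
    rw [ha_ne (i + 1) (by have := mem_range.1 hi; omega)]
  have hENpos : 0 < ∏ i ∈ range 6, ((b 0 : ℚ) - b (i + 1)) := prod_pos fun i hi => by
    have := hc i hi
    have : ((b (i + 1) : ℤ) : ℚ) + 2 ≤ ((b 0 : ℤ) : ℚ) := by exact_mod_cast this
    linarith
  have hEN1pos : 0 < ∏ i ∈ range 6, ((b 0 : ℚ) - 1 - b (i + 1)) := prod_pos fun i hi => by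
    have := hc i hi
    have : ((b (i + 1) : ℤ) : ℚ) + 2 ≤ ((b 0 : ℤ) : ℚ) := by exact_mod_cast this
    linarith
  have hEN : ∏ i ∈ range 6, ((b 0 : ℚ) - b (i + 1)) =
      (b 0 : ℚ) ^ 6 - fe1 a * (b 0 : ℚ) ^ 5 + fe2 a * (b 0 : ℚ) ^ 4 - fe3 a * (b 0 : ℚ) ^ 3 +
        fe4 a * (b 0 : ℚ) ^ 2 - fe5 a * (b 0 : ℚ) + fe6 a := by
    rw [prod_congr rfl fun i hi => by rw [hslot i hi], prod_sub_slots a]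
  have hEN1 : ∏ i ∈ range 6, ((b 0 : ℚ) - 1 - b (i + 1)) =
      ((b 0 : ℚ) - 1) ^ 6 - fe1 a * ((b 0 : ℚ) - 1) ^ 5 + fe2 a * ((b 0 : ℚ) - 1) ^ 4 -
        fe3 a * ((b 0 : ℚ) - 1) ^ 3 + fe4 a * ((b 0 : ℚ) - 1) ^ 2 - fe5 a * ((b 0 : ℚ) - 1) + fe6 a := by
    rw [prod_congr rfl fun i hi => by rw [hslot i hi], prod_sub_slots a]
  have hE6 : ∏ i ∈ range 6, (b (i + 1) : ℚ) = fe6 a := by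
    rw [prod_congr rfl fun i hi => by rw [hslot i hi], prod_slots a]
  have hE1 : ∏ i ∈ range 6, ((b (i + 1) : ℚ) - 1) = 1 - fe1 a + fe2 a - fe3 a + fe4 a - fe5 a + fe6 a := by
    rw [prod_congr rfl fun i hi => by rw [hslot i hi],
      show ∏ i ∈ range 6, ((a (i + 1) : ℚ) - 1) = ∏ i ∈ range 6, (1 - (a (i + 1) : ℚ)) by
        simp only [prod_range_succ, prod_range_zero]; ring,
      prod_sub_slots a]
    ring
  -- the nonzero multiplier
  have hdb : (0 : ℚ) ≤ (dOf b : ℚ) := by exact_mod_cast hd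
  have hN4q : (4 : ℚ) ≤ ((b 0 : ℤ) : ℚ) := by exact_mod_cast hN4
  have hK : ((dOf b : ℚ) + 1) * ((dOf b : ℚ) + 2) *
      (((b 0 : ℚ) - 2) * (∏ i ∈ range 6, ((b 0 : ℚ) - b (i + 1))) * ∏ i ∈ range 6, ((b 0 : ℚ) - 1 - b (i + 1))) ≠ 0 :=
    mul_ne_zero (mul_ne_zero (by intro h; linarith) (by intro h; linarith))
      (mul_ne_zero (mul_ne_zero (by intro h; linarith) hENpos.ne') hEN1pos.ne')
  rw [hEN] at hP1 hK
  rw [hEN1] at hP2 hK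
  rw [hEN, hEN1, hE6, hE1] at hΩ
  refine mul_left_cancel₀ hK ?_
  -- atoms
  set N : ℚ := (b 0 : ℚ) with hNdef
  set db : ℚ := (dOf b : ℚ) with hdbdef
  set PEN := N ^ 6 - fe1 a * N ^ 5 + fe2 a * N ^ 4 - fe3 a * N ^ 3 + fe4 a * N ^ 2 - fe5 a * N + fe6 a with hPEN
  set PEN1 := (N - 1) ^ 6 - fe1 a * (N - 1) ^ 5 + fe2 a * (N - 1) ^ 4 - fe3 a * (N - 1) ^ 3 +
    fe4 a * (N - 1) ^ 2 - fe5 a * (N - 1) + fe6 a with hPEN1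
  set PE1 := 1 - fe1 a + fe2 a - fe3 a + fe4 a - fe5 a + fe6 a with hPE1
  set Z := (N - 2) * PEN * PEN1 with hZ
  set S := (-1 : ℚ) ^ (b 0).toNat * 4 with hS
  set NF := ((b 0).toNat.factorial : ℚ) with hNF
  set Pb := (allPairs.map fun jk => ((b 0 - b jk.1 - b jk.2).toNat.factorial : ℚ)).prod with hPb
  set Pa1 := (allPairs.map fun jk => ((b 0 - bump a 6 jk.1 - bump a 6 jk.2).toNat.factorial : ℚ)).prod with hPa1
  set Pa := (allPairs.map fun jk => ((b 0 - a jk.1 - a jk.2).toNat.factorial : ℚ)).prod with hPa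
  set Fb := ∏ j ∈ range 7, ((b 0 - b (j + 1)).toNat.factorial : ℚ) with hFb
  set Fa1 := ∏ j ∈ range 7, ((b 0 - bump a 6 (j + 1)).toNat.factorial : ℚ) with hFa1
  set Fa := ∏ j ∈ range 7, ((b 0 - a (j + 1)).toNat.factorial : ℚ) with hFa
  set Db := (((dOf b).toNat.factorial : ℕ) : ℚ) with hDb
  set Da1 := (((dOf b + 2 - 1).toNat.factorial : ℕ) : ℚ) with hDa1
  set Da := (((dOf b + 2).toNat.factorial : ℕ) : ℚ) with hDa
  set Ma := quadM3 a with hMa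
  set M1 := quadM3 (bump a 6) with hM1
  set Mb := quadM3 b with hMb
  set q0 := N ^ 5 - fe1 a * N ^ 4 + fe2 a * N ^ 3 - fe3 a * N ^ 2 + fe4 a * N - fe5 a with hq0
  set g1p := (4 * N ^ 3 - 3 * fe1 a * N ^ 2 + 2 * fe2 a * N - fe3 a) - (N - 1) * (db + 2) with hg1p
  set C' := topGamma0 a * g1p - topGamma1 a * q0 with hC'
  set RHS8 := (N - 2) * PEN * PEN1 - 2 * (N - 1) * fe6 a * PEN1 + N * fe6 a * PE1 with hRHS8
  linear_combination ((db + 2) * Z * NF * Pb * Mb) * hγ3 - ((db + 2) * Z * NF * Pb) * pairB -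
    (Z * NF * Pb * topGamma0 a) * initII - (Z * NF * Pb * topGamma1 a) * initI -
    ((N - 2) * PEN * NF * C' * Ma) * hP2 - ((N - 2) * NF * C' * Ma) * hP1 + ((N - 2) * C') * CFa +
    ((N - 2) * C' * S * Fa) * hD1 + ((N - 2) * C' * S * (db + 2) * Fa) * hD2 +
    ((N - 2) * C' * S * (db + 2) * (db + 2 - 1) * Db) * hF1 +
    ((N - 2) * C' * S * (db + 2) * (db + 2 - 1) * Db * N) * hF2 +
    (S * (db + 2) * (db + 2 - 1) * Db * Fb) * hI2 - ((db + 1) * (db + 2) * S * Db * Fb) * hΩ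


/-- **CF-M3 for every admissible `b` with some `b_j ≤ 2`** (`j ∈ [1,7]`): `b_j ≤ 1` by
`casoratianClosedForm_of_slot_le_one`, the layer `b_j = 2` by transport of `casoratianClosedForm_bseven_two`
along the slot transposition `(j 7)`. In particular CF-M3 holds whenever `min_j b_j ≤ 2`. -/
theorem casoratianClosedForm_of_slot_le_two (b : ℕ → ℤ) (hb : InBox b) (hd : 0 ≤ dOf b)
    (hle : ∀ j ∈ Icc 1 7, b j ≤ b 0) (hpairs : ∀ jk ∈ allPairs, b jk.1 + b jk.2 ≤ b 0) {j : ℕ} (hj : j ∈ Icc 1 7)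
    (hj2 : b j ≤ 2) :
    quadM3 b * (((b 0).toNat.factorial : ℚ) *
        (allPairs.map fun jk => ((b 0 - b jk.1 - b jk.2).toNat.factorial : ℚ)).prod) =
      (-1 : ℚ) ^ (b 0).toNat * 4 * ((dOf b).toNat.factorial : ℚ) *
        (∏ j ∈ range 7, ((b 0 - b (j + 1)).toNat.factorial : ℚ)) * omegaVWP b := by
  obtain ⟨hj1', hj7⟩ := mem_Icc.1 hj
  by_cases hz : b j ≤ 1
  · exact casoratianClosedForm_of_slot_le_one b hb hd hle hpairs hj hz
  have htwo : b j = 2 := by omega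
  -- transport along the transposition (j 7)
  have h77 : (7 : ℕ) ∈ Icc 1 7 := mem_Icc.2 ⟨by norm_num, le_rfl⟩
  have e00 : Equiv.swap j 7 0 = 0 := Equiv.swap_apply_of_ne_of_ne (by omega) (by omega)
  have hrange : ∀ i, i ∈ Icc 1 7 → Equiv.swap j 7 i ∈ Icc 1 7 := by
    intro i hi
    obtain ⟨hi1, hi7⟩ := mem_Icc.1 hi
    rw [Equiv.swap_apply_def]
    split_ifs <;> simp only [mem_Icc] <;> omega
  set b' : ℕ → ℤ := fun i => b (Equiv.swap j 7 i) with hb'def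
  have eslot : ∀ i, b' i = b (Equiv.swap j 7 i) := fun i => rfl
  have e0 : b' 0 = b 0 := by rw [eslot, e00]
  have e7 : b' 7 = 2 := by rw [eslot, Equiv.swap_apply_right]; exact htwo
  have hb' : InBox b' := by
    refine ⟨by rw [e0]; exact hb.1, fun i hi => ?_⟩
    have hi7 := mem_range.1 hi
    obtain ⟨hm1, hm7⟩ := mem_Icc.1 (hrange (i + 1) (mem_Icc.2 ⟨by omega, by omega⟩))
    have := hb.2 (Equiv.swap j 7 (i + 1) - 1) (mem_range.2 (by omega))
    rw [Nat.sub_add_cancel hm1] at this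
    rw [eslot, e0]; exact this
  have hsum' : ∑ i ∈ range 7, b' (i + 1) = ∑ i ∈ range 7, b (i + 1) := by
    simp only [eslot]
    refine Finset.sum_equiv (Equiv.swap (j - 1) (7 - 1)) (fun i => ?_) (fun i _ => by rw [swap_succ hj1' (by norm_num)])
    simp only [mem_range]
    rw [Equiv.swap_apply_def]
    split_ifs <;> omega
  have hd' : dOf b' = dOf b := by unfold dOf; rw [hsum', e0]
  have hle' : ∀ i ∈ Icc 1 7, b' i ≤ b' 0 := fun i hi => by rw [eslot, e0]; exact hle _ (hrange i hi)
  have hpairs' : ∀ jk ∈ allPairs, b' jk.1 + b' jk.2 ≤ b' 0 := by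
    intro jk hjk
    obtain ⟨h1, h12, h2⟩ := allPairs_bounds jk hjk
    obtain ⟨hm1, hm1'⟩ := mem_Icc.1 (hrange jk.1 (mem_Icc.2 ⟨h1, by omega⟩))
    obtain ⟨hm2, hm2'⟩ := mem_Icc.1 (hrange jk.2 (mem_Icc.2 ⟨by omega, h2⟩))
    have hne : Equiv.swap j 7 jk.1 ≠ Equiv.swap j 7 jk.2 := fun h => by
      have := (Equiv.swap j 7).injective h; omega
    rw [eslot, eslot, e0]
    exact pair_le_of_allPairs hpairs hm1 hm1' hm2 hm2' hne
  have key := casoratianClosedForm_bseven_two b' hb' (by rw [hd']; exact hd) hle' hpairs' e7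
  have hq : quadM3 b' = quadM3 b := quadM3_swap b hj h77
  have hP : (allPairs.map fun jk => ((b' 0 - b' jk.1 - b' jk.2).toNat.factorial : ℚ)).prod =
      (allPairs.map fun jk => ((b 0 - b jk.1 - b jk.2).toNat.factorial : ℚ)).prod := by
    simp only [eslot, e00]
    exact pairProd_swap7 b hj
  have hF : ∏ i ∈ range 7, ((b' 0 - b' (i + 1)).toNat.factorial : ℚ) =
      ∏ i ∈ range 7, ((b 0 - b (i + 1)).toNat.factorial : ℚ) := by
    simp only [eslot, e00]
    refine Finset.prod_equiv (Equiv.swap (j - 1) (7 - 1)) (fun i => ?_) (fun i _ => by rw [swap_succ hj1' (by norm_num)])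
    simp only [mem_range]
    rw [Equiv.swap_apply_def]
    split_ifs <;> omega
  have hΩ : omegaVWP b' = omegaVWP b := omegaVWP_swap b hj h77
  rw [hq, hP, hF, hΩ, hd', e0] at key
  exact key

end Summit.KontsevichZagierPeriods.Zeta5Search.WedgeDictionary
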